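import Summits.HodgeConjecture.HodgeConjecture.Theses.QbarEnvelope
import Summits.HodgeConjecture.HodgeConjecture.Theses.PeriodDeficiency
import Summits.HodgeConjecture.HodgeConjecture.Theses.LinearSystemTorelli
import Summits.HodgeConjecture.HodgeConjecture.Theorems.LinearSystemTorelliMiddleDivisorSupportFourfoldOfPeriodDeficiency
import Summits.HodgeConjecture.HodgeConjecture.Theorems.QbarEnvelopeEnvelopeStubNumberFieldModel
import Literature.AlgebraicGeometry.FundamentalGroup.RiemannExistenceSmoothAffine
import Literature.AlgebraicGeometry.HodgeTheory.AlgebraicCyclesDefinedOverQbarSpread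
import Literature.AlgebraicGeometry.HodgeTheory.HodgeConjectureQbarVoisin

/-!
# Line `via-hodge-genericity` — `Envelope` (stmt-HodgeConjecture-1069) DOWNSTREAM of the sibling crux HGQ (stmt-11595)

Crux-strategist line (planner-cstrat-stmt-HodgeConjecture-1069-s2-0, 2026-08-17; lens: STRENGTHEN),
registered next to the live skeleton `Lines/birth.lean` (never over it); concludes the crux BY NAME.

The live line's kernel T (type stability of ONE rational `(p,p)` class along loops at a `ℚ̄`-generic
point) is replaced by the STRONGER, more rigid statement HGQ = `PeriodDeficiency.QbarGenericIsHodgeGeneric`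
(stmt-11595: a `ℚ̄`-generic point is HODGE-GENERIC — maximal Mumford–Tate group — in its `ℚ̄`-Zariski
closure; KOU Conj. 1.5 (a), geometric case), which has its OWN live line (`Cruxes/QbarGenericIsHodgeGeneric`,
4/6 stubs landed, open core = Mumford–Tate rank invariance under `Aut(ℂ/ℚ̄)`) and its own instrument on
route `PeriodDeficiency` (DeficiencyBound + BKU Thm. 2.3). What the added rigidity buys: Hodge-genericity
is a statement about a REDUCTIVE GROUP, so the André–Deligne monodromy theorem applies — at a Hodge-generic
point the algebraic monodromy group is contained in the (generic) Mumford–Tate group, whence every Hodge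
class there has FINITE monodromy orbit: the named Literature fact `bku_finite_monodromyOrbit_of_isHodgeGenericIn`
(Baldi–Klingler–Ullmo 2024 §3.2 / André 1992 Thm. 1), reduced in the tree to the analytic dichotomy of
Hodge loci (`bku_finite_monodromyOrbit_of_isHodgeGenericIn_of_hodgeLociDichotomy`, Deligne's Baire argument
PROVED). The road HGQ ⟹ dominant `ℚ̄`-envelope, all `(n,p)`, is the tree's
`Theorems.linearSystemTorelli_dominantQbarEnvelope_of_qbarGenericIsHodgeGeneric` (p119707, for the sister
crux stmt-2409); this file closes the recorded "gap to stmt-1069 verbatim" (number-field descent N —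
LANDED p145483 — and transitivity of base change) and feeds Riemann existence from its DISCHARGE
(`FundamentalGroup.riemannExistence_qbarDescent_of_finiteIndex_holds`, 2026-08-17), so that the stubs are:

* `stub_classicalGeometricVHS` = `PeriodDeficiency.ClassicalGeometricVHS` (stmt-11597, support; known
  mathematics, XL: classical Betti–Hodge datum + geometric VHS data of smooth projective families);
* `stub_qbarGenericIsHodgeGeneric` = `PeriodDeficiency.QbarGenericIsHodgeGeneric` (stmt-11595, crux, OPEN,
  staffed: lead c1, skeleton r4);
* `stub_bkuFiniteMonodromyOrbit` = the named fact `bku_finite_monodromyOrbit_of_isHodgeGenericIn`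
  (published theorem; harness Literature debt, actively being discharged: `HodgeLociDichotomyOfHolomorphicFrames`,
  `HodgeFramesOfHolomorphicSubbundles`);
* `stub_deligneGlobalInvariantCycles` = `LinearSystemTorelli.DeligneGlobalInvariantCycles` (stmt-16363; verbatim
  the live line's D).

`Envelope_of : S₁ → S₂ → S₃ → D → Envelope` is sorry-free (std axioms). The three by-name stubs are EXISTING
items / a named fact staffed elsewhere; they are deliberately NOT re-registered as sub-goals of stmt-1069
(no `stub-add`): this line is the kernel-checked record that stmt-1069 is DOWNSTREAM of route
`PeriodDeficiency`'s HGQ (movement there = movement here), offered to the continuation lead as a switch.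
Disproof used: none relevant (no `Cruxes/Envelope/Disproof.lean`; negatives index touches no stub).
-/

set_option linter.dupNamespace false

namespace Summit.HodgeConjecture.HodgeConjecture.Cruxes.Envelope.ViaHodgeGenericity

open CategoryTheory AlgebraicGeometry Topology
open Literature.AlgebraicGeometry Literature.AlgebraicGeometry.Motives
open Literature.AlgebraicGeometry.HodgeTheory
open Literature.AlgebraicTopology.SingularHomology

/-! ### The stubs -/

/-- **S₁ — classical geometric VHS data exist** = route item stmt-HodgeConjecture-11597 BY NAME
(`PeriodDeficiency.ClassicalGeometricVHS`: a classical Betti–Hodge datum `B`, Deligne's tensor facts, and a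
geometric VHS datum with finite-dimensional fibres on every smooth projective family over a smooth
irreducible `ℚ̄`-base). Known mathematics (Hodge decomposition, Ehresmann + proper base change, Hodge II
§1), formally XL. [cite: VoisinHodgeII2003, §3.1] [cite: DeligneHodgeII1971, §1.1–1.2] -/
theorem stub_classicalGeometricVHS :
    Summit.HodgeConjecture.HodgeConjecture.Theses.PeriodDeficiency.ClassicalGeometricVHS := by
  sorry

/-- **S₂ — a `ℚ̄`-generic point is Hodge-generic in its `ℚ̄`-Zariski closure (HGQ)** = route crux
stmt-HodgeConjecture-11595 BY NAME (`PeriodDeficiency.QbarGenericIsHodgeGeneric`; KOU Conj. 1.5 (a),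
geometric case; OPEN; its own line reduces it to the family-free core "Mumford–Tate rank of `Hⁱ(X^τ)` =
that of `Hⁱ(X)`", 4/6 stubs landed). Why it might fail: a special point of a `ℚ̄`-family at a transcendental
parameter (then HC fails too). [cite: KlinglerOtwinowskaUrbanik2023, Conj. 1.5 (a), Thm. 1.12, Cor. 1.14]
[cite: BaldiKlinglerUllmo2024, §3] [cite: Voisin2007HodgeLoci, Thm. 0.5] -/
theorem stub_qbarGenericIsHodgeGeneric :
    Summit.HodgeConjecture.HodgeConjecture.Theses.PeriodDeficiency.QbarGenericIsHodgeGeneric := by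
  sorry

/-- **S₃ — Hodge classes at Hodge-generic points have finite monodromy orbits** = the named Literature
fact `bku_finite_monodromyOrbit_of_isHodgeGenericIn` VERBATIM (André–Deligne: at a Hodge-generic point the
algebraic monodromy is contained in the generic Mumford–Tate group, under which Hodge classes are
semi-invariant; Baldi–Klingler–Ullmo 2024 §3.2). A published theorem; in the tree it is reduced to the
analytic dichotomy of Hodge loci (`…_of_hodgeLociDichotomy`) and to holomorphic Hodge frames
(`…_of_holomorphicHodgeFrames`). [cite: BaldiKlinglerUllmo2024, §3.2] [cite: Andre1992, Thm. 1]
[cite: Deligne1972WeilK3, Prop. 7.5] -/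
theorem stub_bkuFiniteMonodromyOrbit : bku_finite_monodromyOrbit_of_isHodgeGenericIn := by
  sorry

/-- **D — Deligne's global invariant cycle theorem** = route item stmt-HodgeConjecture-16363 BY NAME
(verbatim the live line's stub D). [cite: DeligneHodgeII1971, Thm. 4.1.1] -/
theorem stub_deligneGlobalInvariantCycles :
    Summit.HodgeConjecture.HodgeConjecture.Theses.LinearSystemTorelli.DeligneGlobalInvariantCycles := by
  sorry

/-! ### Sorry-free links -/

/-- The route decl of stmt-16363 IS the named fact `deligne_globalInvariantCycles`: `Iff.rfl`. [folklore] -/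
theorem deligneGlobalInvariantCycles_iff :
    Summit.HodgeConjecture.HodgeConjecture.Theses.LinearSystemTorelli.DeligneGlobalInvariantCycles ↔
      deligne_globalInvariantCycles :=
  Iff.rfl

/-- **Transitivity of base change**: `(X_φ)_σ ≅ X_{σ ∘ φ}` (Mathlib `Over.pullbackComp`). [folklore] -/
theorem nonempty_iso_baseChangeHom_comp {k L M : Type} [CommRing k] [CommRing L] [CommRing M]
    (φ : k →+* L) (σ : L →+* M) (X : SchemeOver k) :
    Nonempty ((baseChangeHom σ).obj ((baseChangeHom φ).obj X) ≅ (baseChangeHom (σ.comp φ)).obj X) := by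
  have h : Spec.map (CommRingCat.ofHom (σ.comp φ)) =
      Spec.map (CommRingCat.ofHom σ) ≫ Spec.map (CommRingCat.ofHom φ) := by
    rw [CommRingCat.ofHom_comp, Spec.map_comp]
  refine ⟨((CategoryTheory.Over.pullbackComp (Spec.map (CommRingCat.ofHom σ))
      (Spec.map (CommRingCat.ofHom φ))).app X).symm ≪≫ CategoryTheory.eqToIso ?_⟩
  change (CategoryTheory.Over.pullback _).obj X = (CategoryTheory.Over.pullback _).obj X
  rw [h]

/-! ### Composition: the stubs conclude the crux BY NAME -/

/-- **Assembly, implication form** (kernel-checked, no `sorry`): S₁ → S₂ → S₃ → D → `Envelope`. Fix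
`σ : ℚ̄ →+* ℂ`; the tree's `linearSystemTorelli_dominantQbarEnvelope_of_qbarGenericIsHodgeGeneric` (p119707:
spread, HGQ ⟹ Hodge-generic at the `ℚ̄`-generic point ⟹ finite monodromy by S₃ ⟹ Voisin's mechanism B with
Riemann existence — DISCHARGED, `riemannExistence_qbarDescent_of_finiteIndex_holds` — and D) gives
`c = ι^* c'` on a smooth projective `W₀ ⊗_σ ℂ`; `W₀` is smooth projective over `ℚ̄`
(`isSmoothProjective_of_baseChangeHom`), has a number-field model (N, `Theorems.stub_numberFieldModel`,
LANDED p145483), and the base changes compose. [cite: CharlesSchnell2014Notes, Thm. 11.3.19]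
[cite: Voisin2007HodgeLoci, §3, proof of Prop. 0.7] -/
theorem Envelope_of :
    Summit.HodgeConjecture.HodgeConjecture.Theses.PeriodDeficiency.ClassicalGeometricVHS →
    Summit.HodgeConjecture.HodgeConjecture.Theses.PeriodDeficiency.QbarGenericIsHodgeGeneric →
    bku_finite_monodromyOrbit_of_isHodgeGenericIn →
    Summit.HodgeConjecture.HodgeConjecture.Theses.LinearSystemTorelli.DeligneGlobalInvariantCycles →
    Summit.HodgeConjecture.HodgeConjecture.Theses.QbarEnvelope.Envelope := by
  intro hC hG hB hD
  unfold Summit.HodgeConjecture.HodgeConjecture.Theses.QbarEnvelope.Envelope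
  intro n X hX p c hc hh
  obtain ⟨σ⟩ := exists_ringHom_algebraicClosure_rat_complex
  obtain ⟨m, W₀, ι, c', hW, -, hc', hh', hmap⟩ :=
    Theorems.linearSystemTorelli_dominantQbarEnvelope_of_qbarGenericIsHodgeGeneric hC hG hB
      Literature.AlgebraicGeometry.FundamentalGroup.riemannExistence_qbarDescent_of_finiteIndex_holds
      (deligneGlobalInvariantCycles_iff.1 hD) σ hX p c hc hh
  obtain ⟨K, hK₀, hKn, ι₀, W₁, ⟨e₁⟩⟩ :=
    Theorems.stub_numberFieldModel W₀ (isSmoothProjective_of_baseChangeHom σ W₀ hW)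
  obtain ⟨e₂⟩ := nonempty_iso_baseChangeHom_comp ι₀ σ W₁
  exact ⟨m, (baseChangeHom σ).obj W₀, ι, c', hW,
    ⟨K, hK₀, hKn, σ.comp ι₀, W₁, ⟨(baseChangeHom σ).mapIso e₁ ≪≫ e₂⟩⟩, hc', hh', hmap⟩

/-- **The crux from the stubs, by name** (no `sorry` of its own). [folklore] -/
theorem Envelope_of_stubs : Summit.HodgeConjecture.HodgeConjecture.Theses.QbarEnvelope.Envelope :=
  Envelope_of stub_classicalGeometricVHS stub_qbarGenericIsHodgeGeneric stub_bkuFiniteMonodromyOrbit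
    stub_deligneGlobalInvariantCycles

end Summit.HodgeConjecture.HodgeConjecture.Cruxes.Envelope.ViaHodgeGenericity
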